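import Literature.InformationTheory.QuantumCodes.ToricCodeLossErrorDuality
import HarnessLib

/-!
# The loss–error phase diagram of the toric code: census forms

Venture QEC, `Summits/Ventures/QEC/Thresholds/` (LADDER-QEC rung Q5; qec-type-03 gen 6, PARTITION item 138 «03.SBDPHASE»).
Packaging of `Literature/InformationTheory/QuantumCodes/ToricCodeLossErrorPhaseBoundary.lean` (`Z` sector) and
`ToricCodeLossErrorDuality.lean` (`X` sector, by lattice self-duality) for the census object `fun L => toricCode (L + 1)`,
BOTH SECTORS, and assembly of the whole certified phase diagram of the toric code under heralded LOSSES
(rate `y`, known locations) AND independent `Z`-ERRORS (rate `p`), for every family `D` of minimum-weight-outside-the-losses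
decoders (Stace–Barrett–Doherty 2009, Fig. 2), `p_c(y) := accuracyThreshold (mixedFamily D y)`:

| loss rate | certified statement | source |
|---|---|---|
| `0 ≤ y < 1/2` | `0 < p_c(y)` (Peierls argument on the degraded lattice; BK + Kesten), both sectors | `mixed_accuracyThreshold_pos`, `xMixed_accuracyThreshold_pos_iff` (type-03 g6) |
| `0 ≤ y < 1/2` | `p_c(y) ≤ (1 - 2y)/(4(1 - y))` for EVERY decoder (no-cloning ceiling curve) | `mixed_accuracyThreshold_le` (lit-2) |
| `1/2 ≤ y ≤ 1` | `p_c(y) = 0` for EVERY decoder | `mixed_accuracyThreshold_eq_zero` (type-03 g5) |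
| `p = 0` axis | loss threshold `= 1/2` exactly | `erasure_accuracyThreshold_eq_half` (type-03 g5) |

so the set of loss rates at which the toric code retains a positive error threshold is EXACTLY `[0, 1/2)`
(`toric_lossError_correctableLossRates_eq`). HONEST FRAMING: the numerical position of the boundary curve inside the strip
`0 < p_c(y) ≤ (1-2y)/(4(1-y))` (SBD09 Fig. 2) is the VALIDATED column and is not claimed; `p₀(y)` here is Kesten's
non-explicit decay rate fed through an explicit Peierls constant. UNCONDITIONAL, 0 named facts.

## References

* [StaceBarrettDoherty2009] T. M. Stace, S. D. Barrett, A. C. Doherty, *Thresholds for topological codes in the presence of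
  loss*, PRL 102 (2009) 200501, p. 1 (abstract), p. 2–3 and Fig. 2.
* [KestenCMP1980] H. Kesten, Comm. Math. Phys. 74 (1980) 41–59, Thm. 1, Thm. 2 (1.7).
* [DumerKovalevPryadko2015] I. Dumer, A. A. Kovalev, L. P. Pryadko, PRL 115 (2015) 050502, Thm. 2 (the decoder class).
-/

noncomputable section

namespace Summit.Ventures.QEC.Thresholds

open Filter Topology
open Literature.InformationTheory.QuantumCodes
open Literature.InformationTheory.QuantumCodes.ToricCode

/-! ### Census form: the `Z`-sector loss–error family of `fun L => toricCode (L + 1)` -/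

/-- The census `Z`-sector loss–error failure family of the toric codes (checks `(toricCode (L+1)).HX`, trivial errors
`rowSpZ`, decoders `D L`, losses `y`, errors `p`) IS `ToricCode.mixedFamily D y` (definitional).
[cite: StaceBarrettDoherty2009, p. 2 (loss and computational errors on the toric code)] -/
theorem toric_zMixedFamily_eq (D : (L : ℕ) → ErasureDecoder (Edge (L + 1)) (Syndrome (L + 1))) (y : ℝ) :
    (fun L p => mixedFailureProb (toricCode (L + 1)).HX ((toricCode (L + 1)).rowSpZ : Set (Chain (L + 1))) (D L) y p) =
      mixedFamily D y := rfl

/-- ★ **Census form of the phase boundary**: for `0 ≤ y ≤ 1` and every family of minimum-weight-outside-the-losses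
decoders of the census toric codes, the `Z`-sector error accuracy threshold at loss rate `y` is positive iff `y < 1/2`.
[cite: StaceBarrettDoherty2009, p. 1 (abstract) and Fig. 2] -/
theorem toric_z_lossError_accuracyThreshold_pos_iff (D : (L : ℕ) → ErasureDecoder (Edge (L + 1)) (Syndrome (L + 1)))
    (hD : ∀ L, (D L).IsMinWeightOutside (toricCode (L + 1)).HX) {y : ℝ} (hy0 : 0 ≤ y) (hy1 : y ≤ 1) :
    0 < accuracyThreshold (fun L p =>
        mixedFailureProb (toricCode (L + 1)).HX ((toricCode (L + 1)).rowSpZ : Set (Chain (L + 1))) (D L) y p) ↔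
      y < 1 / 2 := by
  rw [toric_zMixedFamily_eq]
  exact mixed_accuracyThreshold_pos_iff D hD hy0 hy1

/-! ### Census form: the `X`-sector loss–error family of `fun L => toricCode (L + 1)` -/

/-- The census `X`-sector loss–error failure family of the toric codes (checks `(toricCode (L+1)).HZ`, trivial errors
`rowSpX`, `X`-decoders `DX L`) IS the `Z`-sector family of the conjugate decoders (lattice self-duality,
`ToricCode.mixedFailureProb_dual`). [cite: StaceBarrettDoherty2009, p. 2 (losses affect both logical operators alike)] -/
theorem toric_xMixedFamily_eq (DX : (L : ℕ) → ErasureDecoder (Edge (L + 1)) (Vertex (L + 1) → ZMod 2)) (y : ℝ) :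
    (fun L p => mixedFailureProb (toricCode (L + 1)).HZ ((toricCode (L + 1)).rowSpX : Set (Chain (L + 1))) (DX L) y p) =
      mixedFamily (fun L => dualErasureDecoder (DX L)) y :=
  xMixedFamily_eq_mixedFamily_dual DX y

/-- ★ **Census form of the phase boundary, `X` sector**: for `0 ≤ y ≤ 1` and every family of
minimum-weight-outside-the-losses `X`-decoders of the census toric codes, the `X`-sector error accuracy threshold at loss
rate `y` is positive iff `y < 1/2`. [cite: StaceBarrettDoherty2009, p. 1 (abstract) and Fig. 2] -/
theorem toric_x_lossError_accuracyThreshold_pos_iff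
    (DX : (L : ℕ) → ErasureDecoder (Edge (L + 1)) (Vertex (L + 1) → ZMod 2))
    (hDX : ∀ L, (DX L).IsMinWeightOutside (toricCode (L + 1)).HZ) {y : ℝ} (hy0 : 0 ≤ y) (hy1 : y ≤ 1) :
    0 < accuracyThreshold (fun L p =>
        mixedFailureProb (toricCode (L + 1)).HZ ((toricCode (L + 1)).rowSpX : Set (Chain (L + 1))) (DX L) y p) ↔
      y < 1 / 2 :=
  xMixed_accuracyThreshold_pos_iff DX hDX hy0 hy1

/-- ★ **Both sectors, census form**: the loss rates at which the census toric codes keep a positive error threshold are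
EXACTLY `[0, 1/2)` in the `Z` sector AND in the `X` sector (any minimum-weight-outside-the-losses decoder families `D`, `DX`).
[cite: StaceBarrettDoherty2009, p. 1 (abstract: the maximum tolerable loss rate is 50%) and Fig. 2] [cite: KestenCMP1980, Thm. 1] -/
theorem toric_lossError_correctableLossRates_eq_bothSectors
    (D : (L : ℕ) → ErasureDecoder (Edge (L + 1)) (Syndrome (L + 1)))
    (hD : ∀ L, (D L).IsMinWeightOutside (toricCode (L + 1)).HX)
    (DX : (L : ℕ) → ErasureDecoder (Edge (L + 1)) (Vertex (L + 1) → ZMod 2))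
    (hDX : ∀ L, (DX L).IsMinWeightOutside (toricCode (L + 1)).HZ) :
    {y : ℝ | 0 ≤ y ∧ y ≤ 1 ∧ 0 < accuracyThreshold (fun L p =>
        mixedFailureProb (toricCode (L + 1)).HX ((toricCode (L + 1)).rowSpZ : Set (Chain (L + 1))) (D L) y p)} =
      Set.Ico 0 (1 / 2) ∧
    {y : ℝ | 0 ≤ y ∧ y ≤ 1 ∧ 0 < accuracyThreshold (fun L p =>
        mixedFailureProb (toricCode (L + 1)).HZ ((toricCode (L + 1)).rowSpX : Set (Chain (L + 1))) (DX L) y p)} =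
      Set.Ico 0 (1 / 2) := by
  constructor
  · ext y
    simp only [Set.mem_setOf_eq, Set.mem_Ico]
    constructor
    · rintro ⟨hy0, hy1, hpos⟩
      exact ⟨hy0, (toric_z_lossError_accuracyThreshold_pos_iff D hD hy0 hy1).1 hpos⟩
    · rintro ⟨hy0, hy⟩
      exact ⟨hy0, by linarith, (toric_z_lossError_accuracyThreshold_pos_iff D hD hy0 (by linarith)).2 hy⟩
  · ext y
    simp only [Set.mem_setOf_eq, Set.mem_Ico]
    constructor
    · rintro ⟨hy0, hy1, hpos⟩
      exact ⟨hy0, (toric_x_lossError_accuracyThreshold_pos_iff DX hDX hy0 hy1).1 hpos⟩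
    · rintro ⟨hy0, hy⟩
      exact ⟨hy0, by linarith, (toric_x_lossError_accuracyThreshold_pos_iff DX hDX hy0 (by linarith)).2 hy⟩

/-! ### The assembled phase diagram -/

/-- ★ **The certified loss–error phase diagram of the toric code** (all decoder families of the
minimum-weight-outside-the-losses class): below the percolation point the error threshold is POSITIVE and at most the
no-cloning ceiling `(1 - 2y)/(4(1 - y))`; from the percolation point on it VANISHES.
[cite: StaceBarrettDoherty2009, p. 2–3 and Fig. 2] [cite: KestenCMP1980, Thm. 1] -/
theorem toric_lossError_phaseDiagram (D : (L : ℕ) → ErasureDecoder (Edge (L + 1)) (Syndrome (L + 1)))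
    (hD : ∀ L, (D L).IsMinWeightOutside (starMatrix (L + 1))) {y : ℝ} (hy0 : 0 ≤ y) (hy1 : y ≤ 1) :
    (y < 1 / 2 → 0 < accuracyThreshold (mixedFamily D y) ∧
        accuracyThreshold (mixedFamily D y) ≤ (1 - 2 * y) / (4 * (1 - y))) ∧
      (1 / 2 ≤ y → accuracyThreshold (mixedFamily D y) = 0) :=
  ⟨fun hy => ⟨mixed_accuracyThreshold_pos D hD hy0 hy, mixed_accuracyThreshold_le D hy0 hy⟩,
    fun hy => mixed_accuracyThreshold_eq_zero D hy hy1⟩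

/-- ★ **The loss rates with a positive error threshold are EXACTLY `[0, 1/2)`**: for every family of
minimum-weight-outside-the-losses decoders, `{y ∈ [0,1] | 0 < p_c(y)} = [0, 1/2)` — the extent of Stace–Barrett–Doherty's
correctable region along the loss axis is the bond-percolation threshold of the square lattice.
[cite: StaceBarrettDoherty2009, p. 1 (abstract: the maximum tolerable loss rate is 50%) and Fig. 2] [cite: KestenCMP1980, Thm. 1] -/
theorem toric_lossError_correctableLossRates_eq (D : (L : ℕ) → ErasureDecoder (Edge (L + 1)) (Syndrome (L + 1)))
    (hD : ∀ L, (D L).IsMinWeightOutside (starMatrix (L + 1))) :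
    {y : ℝ | 0 ≤ y ∧ y ≤ 1 ∧ 0 < accuracyThreshold (mixedFamily D y)} = Set.Ico 0 (1 / 2) := by
  ext y
  simp only [Set.mem_setOf_eq, Set.mem_Ico]
  constructor
  · rintro ⟨hy0, hy1, hpos⟩
    exact ⟨hy0, (mixed_accuracyThreshold_pos_iff D hD hy0 hy1).1 hpos⟩
  · rintro ⟨hy0, hy⟩
    exact ⟨hy0, by linarith, mixed_accuracyThreshold_pos D hD hy0 hy⟩

/-- **Uniformity over decoders and exponential decay** (census reading of `mixedFamily_decaysExponentially`): for every
loss rate `0 ≤ y < 1/2` ONE error rate `p₀(y) > 0` works for all minimum-weight-outside-the-losses decoder families at once,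
with exponentially decaying failure probability for `p ≤ p₀(y)`, hence `p₀(y) ≤ p_c(y)` for all of them.
[cite: StaceBarrettDoherty2009, p. 3 and Fig. 2] [cite: KestenCMP1980, Thm. 2 (1.7)] -/
theorem toric_lossError_uniform_lowerBound {y : ℝ} (hy0 : 0 ≤ y) (hy : y < 1 / 2) :
    ∃ p₀ : ℝ, 0 < p₀ ∧ ∀ (D : (L : ℕ) → ErasureDecoder (Edge (L + 1)) (Syndrome (L + 1))),
      (∀ L, (D L).IsMinWeightOutside (starMatrix (L + 1))) →
        p₀ ≤ accuracyThreshold (mixedFamily D y) ∧ ∀ p : ℝ, 0 ≤ p → p ≤ p₀ → DecaysExponentially (mixedFamily D y) p := by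
  obtain ⟨p₀, hp₀, h⟩ := mixedFamily_decaysExponentially hy0 hy
  refine ⟨min p₀ 1, lt_min hp₀ one_pos, fun D hD => ⟨?_, fun p hp0 hp => h D hD p hp0 (hp.trans (min_le_left _ _))⟩⟩
  refine le_accuracyThreshold (fun p hp0 hp => ?_) (min_le_right _ _)
  exact (h D hD p hp0 ((le_of_lt hp).trans (min_le_left _ _))).belowThreshold

/-- **Non-vacuity (census form)**: with the canonical minimum-weight-outside-the-losses decoders of the census toric
codes, the `Z`-sector error threshold at every loss rate `0 ≤ y < 1/2` is positive.
[cite: DumerKovalevPryadko2015, p. 3 (exhaustive search decoder)] -/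
theorem toric_z_lossError_accuracyThreshold_pos_minWeightOutside {y : ℝ} (hy0 : 0 ≤ y) (hy : y < 1 / 2) :
    0 < accuracyThreshold (fun L p => mixedFailureProb (toricCode (L + 1)).HX
      ((toricCode (L + 1)).rowSpZ : Set (Chain (L + 1)))
      (ErasureDecoder.minWeightOutside (toricCode (L + 1)).HX) y p) :=
  minWeightOutside_mixed_accuracyThreshold_pos hy0 hy

/-- **Non-vacuity (census form, `X` sector)**: with the canonical minimum-weight-outside-the-losses `X`-decoders, the
`X`-sector error threshold at every loss rate `0 ≤ y < 1/2` is positive. [cite: DumerKovalevPryadko2015, p. 3 (exhaustive search decoder)] -/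
theorem toric_x_lossError_accuracyThreshold_pos_minWeightOutside {y : ℝ} (hy0 : 0 ≤ y) (hy : y < 1 / 2) :
    0 < accuracyThreshold (fun L p => mixedFailureProb (toricCode (L + 1)).HZ
      ((toricCode (L + 1)).rowSpX : Set (Chain (L + 1)))
      (ErasureDecoder.minWeightOutside (toricCode (L + 1)).HZ) y p) :=
  minWeightOutside_xMixed_accuracyThreshold_pos hy0 hy

end Summit.Ventures.QEC.Thresholds
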